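import Summits.QuantumAdvantage.QuantumAdvantage.Theorems.LinnikCubicClassGroupsDegreeOnePrimesEscapeThetaDecaySmoothed
import Literature.NumberTheory.LFunctions.ClassGroupLFunctionNoExceptionalZeroOddDegree
import HarnessLib

/-!
# The prime ideal theorem in the Linnik range with an EXPONENTIALLY DECAYING error term, for every
# number field without quadratic subfield — in particular every field of odd degree and every cubic field

Topic `Summits/QuantumAdvantage/QuantumAdvantage/Theorems`, cell B2b-1 (linnik-cubic), PART A (maintenance
seat, generation 15); helper for the crux `DegreeOnePrimesEscape` (stmt-QuantumAdvantage-11543) of route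
`LinnikCubicClassGroups`.  HONEST FRAMING: the value of this file is a THEOREM (kernel-checked, GRH-free,
Siegel-free) — NOT summit progress (the route rests on the hypothesis-type target `PureCubicClassNumberHard`).

From the smoothed bound of `…ThetaDecaySmoothed.lean` (`abs_re_coefFordK_one_sub_le_of_noQuadraticSubfield`),
the log-free zero-density estimate for `ζ₁_K` in every degree (`logFreeDensity_dedekindZeta₁_all`, in `Q`-form via
`lowerPIT_densityQ_local`) and the residue bound `κ_K ≥ Q^{−A(n)}` (`exists_condQn_rpow_neg_le_residue`), with the
trivial unsmoothing `|θ_K(x) − Re K_1(g_x)| ≤ n(log x + 1)(8√x + 2x^{1−ν} + 1)`: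

* `abs_chebyshevThetaIdeal_sub_self_le_of_noQuadraticSubfield` — **for `n > 1` there are `ν, a₁, A, c > 0` such
  that for every number field `K` of degree `n` without quadratic subfield and every `x ≥ Q^{a₁}` (`Q = |d_K|·nⁿ`):
  `|θ_K(x) − x| ≤ A·x·(e^{−c log x / log Q} + e^{−√(c log x)} + x^{−ν})`** — unconditional;
* `abs_chebyshevThetaIdeal_sub_self_le_of_odd` — the same for every field of ODD degree `n`;
* `abs_chebyshevThetaIdeal_sub_self_le_cubic` — the same for every cubic field (`Q = 27|d_K|`).

The tree's earlier prime ideal theorems in the Linnik range carry a FIXED relative error `ε` with a threshold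
`C(ε)`; the decay inside the range is what a uniform Mertens theorem needs (next files).

## References

* J. Thorner, A. Zaman, *A unified and improved Chebotarev density theorem*, Algebra Number Theory 13
  (2019), Thm 1.4 (error term `e^{−c₃ log x/log(D_K Q n^n)} + e^{−(c₄ log x)^{1/2}/n}`). [ThornerZaman2019]
* H. M. Stark, *Some effective cases of the Brauer–Siegel theorem*, Invent. Math. 23 (1974), Thm 3. [Stark1974]
-/

noncomputable section

open Complex Real MeasureTheory Set Filter Topology
open scoped NumberField nonZeroDivisors
open Literature.NumberTheory.LFunctions Literature.NumberTheory.LFunctions.NumberField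
  Literature.NumberTheory.LFunctions.EntireEF Literature.NumberTheory.LFunctions.TZWeight

namespace Summit.QuantumAdvantage.QuantumAdvantage.Theorems.DegreeOnePrimesEscape

/-! ### The prime ideal theorem with a decaying error, unconditionally -/

set_option maxHeartbeats 800000 in
/-- **The prime ideal theorem in the Linnik range with an exponentially decaying error term**, for every
number field of degree `n > 1` WITHOUT QUADRATIC SUBFIELD (GRH-free, Siegel-free, kernel-checked): there are
`ν, a₁, A, c > 0` depending only on `n` such that for every such `K` and every `x ≥ Q^{a₁}`
(`Q = |d_K|·nⁿ`): `|θ_K(x) − x| ≤ A·x·(e^{−c log x / log Q} + e^{−√(c log x)} + x^{−ν})`.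
Density: `logFreeDensity_dedekindZeta₁_all`; residue: `exists_condQn_rpow_neg_le_residue`; zeros:
`allZerosGood_of_noQuadraticSubfield`; smoothing: `tzTest` with `ε = x^{−ν}`, unsmoothed trivially.
[cite: ThornerZaman2019, Thm 1.4 (shape of the error term)] -/
theorem abs_chebyshevThetaIdeal_sub_self_le_of_noQuadraticSubfield (n : ℕ) (hn : 1 < n) :
    ∃ ν a₁ A c : ℝ, 0 < ν ∧ 1 ≤ a₁ ∧ 0 < A ∧ 0 < c ∧
    ∀ (K : Type) [Field K] [NumberField K], Module.finrank ℚ K = n →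
      (∀ F : IntermediateField ℚ K, Module.finrank ℚ F ≠ 2) →
      ∀ x : ℝ, ThornerZaman.condQn K ^ a₁ ≤ x →
        |chebyshevThetaIdeal K x - x| ≤
          A * x * (Real.exp (-(c * Real.log x / Real.log (ThornerZaman.condQn K))) +
            Real.exp (-Real.sqrt (c * Real.log x)) + x ^ (-ν)) := by
  classical
  obtain ⟨Ar, -, hκ⟩ := ThornerZaman.exists_condQn_rpow_neg_le_residue n hn
  obtain ⟨c_D, C_D, hcD, hCD, hdens⟩ := lowerPIT_densityQ_local n hn Ar (logFreeDensity_dedekindZeta₁_all n)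
  have ha4 : (1 : ℝ) ≤ max Ar 4 := le_max_of_le_right (by norm_num)
  obtain ⟨ν, a₁, A, c, hν0, hν64, ha₁1, hA0, hc0, hmain⟩ :=
    abs_re_coefFordK_one_sub_le_of_noQuadraticSubfield n hn hcD hCD ha4
  set A' : ℝ := A + 44 * (n : ℝ) / ν with hA'
  have hn0 : (0 : ℝ) < (n : ℝ) := by exact_mod_cast (lt_trans Nat.zero_lt_one hn)
  have hA'0 : 0 < A' := by positivity
  refine ⟨ν / 2, a₁, A', c, by positivity, ha₁1, hA'0, hc0, fun K _ _ hKn hnq x hx ↦ ?_⟩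
  have hK : 1 < Module.finrank ℚ K := by rw [hKn]; exact hn
  set Q : ℝ := ThornerZaman.condQn K with hQ
  have hQ12 : (12 : ℝ) ≤ Q := ThornerZaman.twelve_le_condQn (K := K) hK
  have hQ1 : (1 : ℝ) < Q := by linarith
  have hQ0 : (0 : ℝ) < Q := by linarith
  have hlog12 : (2 : ℝ) ≤ Real.log 12 := by
    rw [Real.le_log_iff_exp_le (by norm_num)]
    have := Real.exp_one_lt_d9
    have h : Real.exp 2 = Real.exp 1 * Real.exp 1 := by rw [← Real.exp_add]; norm_num
    rw [h]; nlinarith [Real.exp_pos (1:ℝ)]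
  have hlogQ : 2 ≤ Real.log Q := hlog12.trans (Real.log_le_log (by norm_num) hQ12)
  have hxQ : Q ≤ x := by
    have : Q ^ (1 : ℝ) ≤ Q ^ a₁ := Real.rpow_le_rpow_of_exponent_le hQ1.le ha₁1
    rw [Real.rpow_one] at this; linarith
  have hx1 : 1 < x := by linarith
  have hx0 : 0 < x := by linarith
  set L : ℝ := Real.log x with hL
  have hLQ : a₁ * Real.log Q ≤ L := by
    have := Real.log_le_log (by positivity) hx
    rwa [Real.log_rpow hQ0] at this
  have hL2 : 2 ≤ L := by nlinarith
  have hL0 : 0 < L := by linarith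
  -- the smoothed bound
  have hsm := hmain K hKn hnq (hdens K hKn (hκ K hKn)) x hx
  -- unsmoothing
  set ε : ℝ := x ^ (-ν) with hε
  have hε0 : 0 < ε := Real.rpow_pos_of_pos hx0 _
  have hε1 : ε ≤ 1 := Real.rpow_le_one_of_one_le_of_nonpos hx1.le (by linarith)
  have hxε : x ^ (1 - ν) = x * ε := by
    rw [hε, sub_eq_add_neg, Real.rpow_add hx0, Real.rpow_one]
  have hun := abs_thetaChar_sub_re_coefFordK_le (K := K) (1 : ClassGroup (𝓞 K) →* ℂˣ) hx1 hε0
  rw [sum_re_one_mul_chebyshevThetaIdealClass K x] at hun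
  have herr := unsmoothing_error_le (K := K) hx1 hε0 hε1
  rw [hKn] at herr
  -- sizes of the unsmoothing error: `n (log x + 1)(8√x + 2εx + 1) ≤ (44 n/ν) x^{1 − ν/2}`
  have hone : 1 ≤ x ^ (1 - ν) := Real.one_le_rpow hx1.le (by linarith)
  have hsqrt : Real.sqrt x ≤ x ^ (1 - ν) := by
    rw [Real.sqrt_eq_rpow]; exact Real.rpow_le_rpow_of_exponent_le hx1.le (by linarith)
  have hxν0 : 0 ≤ x ^ (1 - ν) := by positivity
  have h11 : 8 * Real.sqrt x + 2 * ε * x + 1 ≤ 11 * x ^ (1 - ν) := by rw [hxε]; nlinarith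
  have hlogx : L + 1 ≤ (4 / ν) * x ^ (ν / 2) := by
    have h1 := Real.log_le_rpow_div hx0.le (by positivity : 0 < ν / 2)
    rw [← hL] at h1
    have h2 : x ^ (ν / 2) / (ν / 2) = (2 / ν) * x ^ (ν / 2) := by field_simp
    rw [h2] at h1
    have h3 : 1 ≤ (2 / ν) * x ^ (ν / 2) := by
      have hx1' : 1 ≤ x ^ (ν / 2) := Real.one_le_rpow hx1.le (by positivity)
      have hν2 : 1 ≤ 2 / ν := by rw [le_div_iff₀ hν0]; linarith
      nlinarith
    have : (4 / ν) * x ^ (ν / 2) = (2 / ν) * x ^ (ν / 2) + (2 / ν) * x ^ (ν / 2) := by ring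
    rw [this]; linarith
  have hpow : x ^ (ν / 2) * x ^ (1 - ν) = x ^ (1 - ν / 2) := by
    rw [← Real.rpow_add hx0]; ring_nf
  have hunsm : (n : ℝ) * ((L + 1) * (8 * Real.sqrt x + 2 * ε * x + 1)) ≤ 44 * (n : ℝ) / ν * x ^ (1 - ν / 2) := by
    have h1 : (L + 1) * (8 * Real.sqrt x + 2 * ε * x + 1) ≤ (4 / ν) * x ^ (ν / 2) * (11 * x ^ (1 - ν)) :=
      mul_le_mul hlogx h11 (by positivity) (by positivity)
    have h2 : (4 / ν) * x ^ (ν / 2) * (11 * x ^ (1 - ν)) = 44 / ν * x ^ (1 - ν / 2) := by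
      rw [← hpow]; ring
    rw [h2] at h1
    have := mul_le_mul_of_nonneg_left h1 hn0.le
    calc (n : ℝ) * ((L + 1) * (8 * Real.sqrt x + 2 * ε * x + 1)) ≤ (n : ℝ) * (44 / ν * x ^ (1 - ν / 2)) := this
      _ = 44 * (n : ℝ) / ν * x ^ (1 - ν / 2) := by ring
  -- `x^{1−ν} ≤ x^{1−ν/2} = x · x^{−ν/2}`
  have hνν : x ^ (1 - ν) ≤ x ^ (1 - ν / 2) := Real.rpow_le_rpow_of_exponent_le hx1.le (by linarith)
  have hsplit' : x ^ (1 - ν / 2) = x * x ^ (-(ν / 2)) := by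
    rw [show (1 - ν / 2 : ℝ) = 1 + (-(ν / 2)) by ring, Real.rpow_add hx0, Real.rpow_one]
  set E : ℝ := Real.exp (-(c * Real.log x / Real.log Q)) + Real.exp (-Real.sqrt (c * Real.log x)) with hE
  have hE0 : 0 ≤ E := by positivity
  -- assemble
  have htri : |chebyshevThetaIdeal K x - x| ≤
      |chebyshevThetaIdeal K x - (coefFordK (cgCoef (1 : ClassGroup (𝓞 K) →* ℂˣ)) (tzTest (Real.log x) ε) 0).re| +
        |(coefFordK (cgCoef (1 : ClassGroup (𝓞 K) →* ℂˣ)) (tzTest (Real.log x) ε) 0).re - x| :=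
    abs_sub_le _ _ _
  have hxν2 : 0 ≤ x ^ (-(ν / 2)) := by positivity
  calc |chebyshevThetaIdeal K x - x|
      ≤ (n : ℝ) * ((L + 1) * (8 * Real.sqrt x + 2 * ε * x + 1)) + (A * x * E + A * x ^ (1 - ν)) := by
        rw [hL]; linarith [hun.trans herr, hsm]
    _ ≤ 44 * (n : ℝ) / ν * x ^ (1 - ν / 2) + (A * x * E + A * x ^ (1 - ν / 2)) := by
        have := mul_le_mul_of_nonneg_left hνν hA0.le
        linarith
    _ = A * x * E + A' * (x * x ^ (-(ν / 2))) - (A + 44 * (n : ℝ) / ν - A') * x ^ (1 - ν / 2) := by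
        rw [hsplit', hA']; ring
    _ = A * x * E + A' * (x * x ^ (-(ν / 2))) := by rw [hA']; ring
    _ ≤ A' * x * E + A' * (x * x ^ (-(ν / 2))) := by
        have h44 : (0 : ℝ) ≤ 44 * (n : ℝ) / ν := by positivity
        have hAA' : A ≤ A' := by rw [hA']; linarith
        gcongr
    _ = A' * x * (E + x ^ (-(ν / 2))) := by ring

/-! ### Odd degree; cubic fields -/

/-- **The prime ideal theorem with decaying error for every number field of ODD degree `n > 1`** (an odd-degree
field has no quadratic subfield, `forall_finrank_ne_two_of_odd`). -/
theorem abs_chebyshevThetaIdeal_sub_self_le_of_odd (n : ℕ) (hn : 1 < n) (hodd : Odd n) :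
    ∃ ν a₁ A c : ℝ, 0 < ν ∧ 1 ≤ a₁ ∧ 0 < A ∧ 0 < c ∧
    ∀ (K : Type) [Field K] [NumberField K], Module.finrank ℚ K = n →
      ∀ x : ℝ, ThornerZaman.condQn K ^ a₁ ≤ x →
        |chebyshevThetaIdeal K x - x| ≤
          A * x * (Real.exp (-(c * Real.log x / Real.log (ThornerZaman.condQn K))) +
            Real.exp (-Real.sqrt (c * Real.log x)) + x ^ (-ν)) := by
  obtain ⟨ν, a₁, A, c, hν, ha₁, hA, hc, h⟩ := abs_chebyshevThetaIdeal_sub_self_le_of_noQuadraticSubfield n hn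
  refine ⟨ν, a₁, A, c, hν, ha₁, hA, hc, fun K _ _ hKn x hx ↦ h K hKn ?_ x hx⟩
  have hoddK : Odd (Module.finrank ℚ K) := by rw [hKn]; exact hodd
  exact forall_finrank_ne_two_of_odd hoddK

/-- **The prime ideal theorem with decaying error for every CUBIC field** (`Q = condQn K = 27·|d_K|`): there are
`ν, a₁, A, c > 0` with `|θ_K(x) − x| ≤ A·x·(e^{−c log x / log Q} + e^{−√(c log x)} + x^{−ν})` for every cubic
number field `K` and every `x ≥ Q^{a₁}` — GRH-free, Siegel-free. -/
theorem abs_chebyshevThetaIdeal_sub_self_le_cubic :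
    ∃ ν a₁ A c : ℝ, 0 < ν ∧ 1 ≤ a₁ ∧ 0 < A ∧ 0 < c ∧
    ∀ (K : Type) [Field K] [NumberField K], Module.finrank ℚ K = 3 →
      ∀ x : ℝ, ThornerZaman.condQn K ^ a₁ ≤ x →
        |chebyshevThetaIdeal K x - x| ≤
          A * x * (Real.exp (-(c * Real.log x / Real.log (ThornerZaman.condQn K))) +
            Real.exp (-Real.sqrt (c * Real.log x)) + x ^ (-ν)) :=
  abs_chebyshevThetaIdeal_sub_self_le_of_odd 3 (by norm_num) (by decide)

end Summit.QuantumAdvantage.QuantumAdvantage.Theorems.DegreeOnePrimesEscape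

end
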